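import Summits.Ventures.CertifiedQuantumChemistry.Rows.SingletNecessaryConditionLowerRows
import HarnessLib

/-!
# Ventures/CertifiedQuantumChemistry — Rows/SingletSpinFlipQuotient.lean: the `M = 0` spin-flip
# quotient is sound for the SINGLET class (`s2=0` + `flip` instances), arbitrary condition set

HONEST FRAMING (verbatim): certified bounds for a stated model Hamiltonian in a stated basis; not a
claim about the real molecule or material beyond that model.

LADDER-CHEM I-TYPE slot 07 (cell chem-oracle, seat chem-type-07 gen 3, 2026-08-26; zero compute; PROVED
glue only — 0 sorry, no `def`, no claim node; nothing here asserts a bound about any pinned file).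
Companion of `Rows/SpinFlipQuotient.lean` (rdm-B: the `θ`-eigen SECTOR ground state, §3, and the
`θ`-symmetry of its moments, §4), `Rows/NecessaryConditionLowerRows.lean` §2 (the flip quotient for an
arbitrary SECTOR-necessary condition set) and `Rows/SingletNecessaryConditionLowerRows.lean` (singlet
rows from an arbitrary SINGLET-necessary condition set) — none edited. FORMAT-qcl1 §8c builds the flip
quotient of ANY instance with `N_α = N_β`, including the `s2=0` (E3 / E4 rows) singlet instances:
"(with the §5 S²/E3/E4 rows: for every state of the stated spin class — that row set is θ-invariant)".
Its VALIDITY for the singlet class needs one fact the tree did not have: the singlet subspace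
`(n, n)-sector ⊓ ker Ŝ_+` is mapped to itself by the Fock-space flip `Γ_θ` (`θ = Orb.spinSwap`):
`Γ_θ Ŝ_+ Γ_θ⁻¹ = Ŝ_−` (§1), and an `M = 0` vector annihilated by `Ŝ_+` is annihilated by `Ŝ_−`
(§2: `‖Ŝ_−φ‖² = ⟨φ, Ŝ_+Ŝ_−φ⟩ = ⟨φ, (Ŝ_−Ŝ_+ + 2Ŝ_z)φ⟩ = 0`, the `su(2)` relation `[Ŝ_+, Ŝ_−] = 2Ŝ_z` of
the tree's `spinPlus_mul_spinMinus_sub`). Hence (§3) a Hermitian, spin-free `Ĥ` has a UNIT SINGLET GROUND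
EIGENVECTOR `ψ` WITH `Γ_θ ψ = ±ψ` (normalise `φ + Γ_θ φ` as in `exists_unit_eigen_sectorGroundEnergy_spinSwap`),
whose RDMs are `θ`-symmetric (`oneRDM_spinSwap_of_eigen`, `twoRDM_spinSwap_of_eigen`), and (§4) a number
below `Re E(γ, Γ)` on the `θ`-SYMMETRIC `C`-feasible pairs of a SINGLET-necessary `C` is
`≤ E₀(Ĥ; N = 2n, S = 0)`: **`singletLowerRow_of_forall_necessary_flip`** (`SingletLowerRow F n lo`), the
rung instances, the one-feasible-point form `exists_feasible_le_singletEnergy_flip_of_necessary` ((★) for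
the singlet quantity from the `θ`-eigen singlet ground state) and the a-posteriori END-TO-END decls a
first-order / `dyadic-eig` certificate of a `qcl1f` `s2=0` instance cites
(`APosteriori.singletLowerRow_of_isEncodingOf_flip`, `APosteriori.singletLowerRow_of_dyadicEigCertificate_flip`).
STATE LEVEL throughout: no convexity / losslessness hypothesis (the quotient's LOSSLESSNESS for the
singlet programme — equal optima — is not claimed here).
References: FORMAT-qcl1 v0.3.0 §8c (in-house `pub-qchem-rdm/FORMAT-qcl1.md`); D. A. Mazziotti, Adv.
Chem. Phys. 134 (2007) ch. 3 §II.F.1 eqs. (96)–(98) (`S`-representability, `Ŝ² = Ŝ_z + Ŝ_z² + Ŝ_−Ŝ_+`;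
held copy p. 50 opened 2026-08-26); H. Tasaki, *Physics and Mathematics of Quantum Many-Body Systems*
(2020) §9.3 (9.3.6) (`su(2)` relations; tree `spin_su2_relations`) and §2.2 (min–max); E. H. Lieb, PRL
62 (1989) 1201 (spin exchange symmetry; tree `relabel_spinSwap_molecularHamiltonian`).
-/

noncomputable section

namespace Summit.Ventures.CertifiedQuantumChemistry

open Matrix Finset
open Literature.MathematicalPhysics.QuantumLattice Literature.MathematicalPhysics.QuantumChemistry
open Literature.Computation.Certificates
open scoped ComplexOrder

section Flip

variable {Λ : Type*} [LinearOrder Λ] [Fintype Λ]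

/-! ## §1 The flip exchanges the spin-raising and spin-lowering operators -/

/-- **`Γ_θ Ŝ_+ Γ_θ⁻¹ = Ŝ_−`**: the spin flip `θ : (x, σ) ↦ (x, 1 − σ)` sends
`Ŝ_+ = Σ_x a†_{x↑} a_{x↓}` to `Σ_x a†_{x↓} a_{x↑} = Ŝ_−` (`relabel_creation`, `relabel_annihilation`,
`spinMinus_eq_sum`). -/
theorem relabel_spinSwap_spinPlus :
    relabel (Orb.spinSwap : Orb Λ ≃ Orb Λ) (spinPlus : Matrix (Finset (Orb Λ)) (Finset (Orb Λ)) ℂ) =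
      Literature.MathematicalPhysics.QuantumLattice.spinMinus := by
  rw [spinPlus, map_sum, spinMinus_eq_sum]
  refine Finset.sum_congr rfl fun x _ => ?_
  rw [map_mul, relabel_creation, relabel_annihilation, Orb.spinSwap_orb, Orb.spinSwap_orb,
    Equiv.swap_apply_left, Equiv.swap_apply_right]

/-- **`Γ_θ Ŝ_− Γ_θ⁻¹ = Ŝ_+`** (the same computation read backwards). -/
theorem relabel_spinSwap_spinMinus :
    relabel (Orb.spinSwap : Orb Λ ≃ Orb Λ)
      (Literature.MathematicalPhysics.QuantumLattice.spinMinus :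
        Matrix (Finset (Orb Λ)) (Finset (Orb Λ)) ℂ) = spinPlus := by
  rw [spinMinus_eq_sum, map_sum, spinPlus]
  refine Finset.sum_congr rfl fun x _ => ?_
  rw [map_mul, relabel_creation, relabel_annihilation, Orb.spinSwap_orb, Orb.spinSwap_orb,
    Equiv.swap_apply_left, Equiv.swap_apply_right]

/-! ## §2 An `M = 0` vector annihilated by `Ŝ_+` is annihilated by `Ŝ_−` -/

/-- `(Ŝ_−)ᴴ = Ŝ_+` (`Ŝ_− := (Ŝ_+)ᴴ`). -/
theorem conjTranspose_spinMinus :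
    (Literature.MathematicalPhysics.QuantumLattice.spinMinus :
      Matrix (Finset (Orb Λ)) (Finset (Orb Λ)) ℂ)ᴴ = spinPlus := by
  rw [Literature.MathematicalPhysics.QuantumLattice.spinMinus, conjTranspose_conjTranspose]

/-- **A SINGLET IS ANNIHILATED BY `Ŝ_−` AS WELL**: if `φ` lies in the balanced sector `(n, n)`
(`Ŝ_z φ = 0`) and `Ŝ_+ φ = 0`, then `Ŝ_− φ = 0` — since
`‖Ŝ_−φ‖² = ⟨φ, Ŝ_+Ŝ_−φ⟩ = ⟨φ, Ŝ_−Ŝ_+φ⟩ + 2⟨φ, Ŝ_zφ⟩ = 0` by the `su(2)` relation `[Ŝ_+, Ŝ_−] = 2Ŝ_z`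
(tree `spinPlus_mul_spinMinus_sub`; Tasaki (2020) (9.3.6); Mazziotti (2007) eq. (97)
`Ŝ² = Ŝ_z + Ŝ_z² + Ŝ_−Ŝ_+`: at `M = 0`, `Ŝ²φ = 0 ⟺ Ŝ_+φ = 0 ⟺ Ŝ_−φ = 0`). -/
theorem spinMinus_mulVec_eq_zero_of_spinPlus {n : ℕ} {φ : Fock (Orb Λ)} (hφ : IsInSector n n φ)
    (hS : spinPlus *ᵥ φ = 0) :
    Literature.MathematicalPhysics.QuantumLattice.spinMinus *ᵥ φ = 0 := by
  have hz : HubbardWave0.spinZ *ᵥ φ = 0 := by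
    have h := ((mem_szSector_iff (n + n) (((n : ℝ) - n) / 2) φ).1
      ((mem_szSector_iff_isInSector n n φ).2 hφ)).2
    rw [sub_self, zero_div, Complex.ofReal_zero, zero_smul] at h
    exact h
  have hcomm : (spinPlus * Literature.MathematicalPhysics.QuantumLattice.spinMinus :
      Matrix (Finset (Orb Λ)) (Finset (Orb Λ)) ℂ) =
      Literature.MathematicalPhysics.QuantumLattice.spinMinus * spinPlus + (2 : ℂ) • HubbardWave0.spinZ := by
    rw [← LiebThm1.spinPlus_mul_spinMinus_sub, add_comm, sub_add_cancel]
  have key : star (Literature.MathematicalPhysics.QuantumLattice.spinMinus *ᵥ φ) ⬝ᵥ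
      (Literature.MathematicalPhysics.QuantumLattice.spinMinus *ᵥ φ) = 0 := by
    rw [star_mulVec, ← dotProduct_mulVec, conjTranspose_spinMinus, mulVec_mulVec, hcomm, add_mulVec,
      ← mulVec_mulVec, hS, mulVec_zero, zero_add, smul_mulVec, hz, smul_zero, dotProduct_zero]
  exact dotProduct_star_self_eq_zero.1 key

/-- **`Γ_θ` MAPS SINGLETS TO SINGLETS**: for `φ` in the sector `(n, n)` with `Ŝ_+ φ = 0`, also
`Ŝ_+ (Γ_θ φ) = 0` (`Ŝ_+ Γ_θ = Γ_θ Ŝ_−` by §1 and `Ŝ_− φ = 0` by §2); with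
`isInSector_relabelVec_spinSwap` the singlet subspace `(n, n)-sector ⊓ ker Ŝ_+` is `Γ_θ`-invariant — the
`θ`-invariance of the `s2=0` row set stated in FORMAT-qcl1 §8c. -/
theorem spinPlus_mulVec_relabelVec_spinSwap_eq_zero {n : ℕ} {φ : Fock (Orb Λ)} (hφ : IsInSector n n φ)
    (hS : spinPlus *ᵥ φ = 0) : spinPlus *ᵥ relabelVec Orb.spinSwap φ = 0 := by
  rw [← relabel_spinSwap_spinMinus, relabel_mulVec_relabelVec, spinMinus_mulVec_eq_zero_of_spinPlus hφ hS,
    relabelVec_zero]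

/-! ## §3 A `θ`-eigen SINGLET ground eigenvector -/

/-- **The singlet class has a `θ`-EIGEN ground state.** For Hermitian spin-free integral data and
`n ≤ |Λ|` there is a unit vector `ψ` of the sector `(n, n)` with `Ŝ_+ψ = 0`,
`Ĥψ = E₀(Ĥ; 2n, S = 0)·ψ` (`E₀(Ĥ; 2n, S = 0)` = `minEnergyOn` of `(n, n)-sector ⊓ ker Ŝ_+`) and
`Γ_θ ψ = ψ` or `Γ_θ ψ = −ψ`. Proof as `exists_unit_eigen_sectorGroundEnergy_spinSwap`: a unit singlet
ground eigenvector `φ` exists (`exists_unit_eigen_minEnergyOn_spinClass`); `Γ_θ φ` is again one (§2,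
`isInSector_relabelVec_spinSwap`, `relabel_spinSwap_molecularHamiltonian`); normalise `φ + Γ_θ φ` if it is
nonzero, else `Γ_θ φ = −φ`. -/
theorem exists_unit_eigen_singlet_spinSwap {h : Λ → Λ → ℂ} {g : Λ → Λ → Λ → Λ → ℂ} {hnuc : ℂ}
    (hH : (molecularHamiltonian h g hnuc).IsHermitian) {n : ℕ} (hn : n ≤ Fintype.card Λ) :
    ∃ ψ : Fock (Orb Λ), IsInSector n n ψ ∧ spinPlus *ᵥ ψ = 0 ∧ star ψ ⬝ᵥ ψ = 1 ∧
      molecularHamiltonian h g hnuc *ᵥ ψ =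
        (((molecularHamiltonian h g hnuc).minEnergyOn
          (szSector (n + n) (((n : ℝ) - n) / 2) ⊓ LinearMap.ker (Matrix.toLin'
            (spinPlus : Matrix (Finset (Orb Λ)) (Finset (Orb Λ)) ℂ))) : ℝ) : ℂ) • ψ ∧
      (relabelVec Orb.spinSwap ψ = ψ ∨ relabelVec Orb.spinSwap ψ = -ψ) := by
  obtain ⟨φ, hφ, hSφ, hφ1, hHφ⟩ := exists_unit_eigen_minEnergyOn_spinClass hH le_rfl hn
  set H := molecularHamiltonian h g hnuc with hHdef
  set E : ℝ := H.minEnergyOn (szSector (n + n) (((n : ℝ) - n) / 2) ⊓ LinearMap.ker (Matrix.toLin'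
    (spinPlus : Matrix (Finset (Orb Λ)) (Finset (Orb Λ)) ℂ))) with hE
  have hswap : relabel Orb.spinSwap H = H := relabel_spinSwap_molecularHamiltonian h g hnuc
  have hHφ' : H *ᵥ relabelVec Orb.spinSwap φ = (E : ℂ) • relabelVec Orb.spinSwap φ := by
    conv_lhs => rw [← hswap]
    rw [relabel_mulVec_relabelVec, hHφ, relabelVec_smul]
  by_cases h0 : φ + relabelVec Orb.spinSwap φ = 0
  · exact ⟨φ, hφ, hSφ, hφ1, hHφ, Or.inr (eq_neg_of_add_eq_zero_right h0)⟩
  · set χ := φ + relabelVec Orb.spinSwap φ with hχ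
    have hχs : IsInSector n n χ := hφ.add (isInSector_relabelVec_spinSwap hφ)
    have hχS : spinPlus *ᵥ χ = 0 := by
      rw [hχ, mulVec_add, hSφ, spinPlus_mulVec_relabelVec_spinSwap_eq_zero hφ hSφ, add_zero]
    have hHχ : H *ᵥ χ = (E : ℂ) • χ := by rw [hχ, mulVec_add, hHφ, hHφ', smul_add]
    have hΓχ : relabelVec Orb.spinSwap χ = χ := by
      rw [hχ, relabelVec_add_eq, relabelVec_spinSwap_relabelVec_spinSwap, add_comm]
    obtain ⟨c, -, hc1⟩ := Literature.MathematicalPhysics.QuantumLattice.exists_smul_unit h0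
    refine ⟨c • χ, hχs.smul c, ?_, hc1, ?_, Or.inl ?_⟩
    · rw [mulVec_smul, hχS, smul_zero]
    · rw [mulVec_smul, hHχ, smul_comm]
    · rw [relabelVec_smul, hΓχ]

/-! ## §4 The flip-quotient bounds for the singlet class -/

/-- **THE SINGLET FLIP-QUOTIENT BOUND for an ARBITRARY singlet-necessary condition set** (Literature
level). Hermitian spin-free data, `n ≤ |Λ|`, `C` necessary for the singlet class of `(n, n)`
(`IsNecessaryInSpinClass n n C`): if `c` lies below `Re E(γ, Γ)` on every `C`-feasible pair WHICH IS
`θ`-SYMMETRIC (the pull-back of a `qcl1f` `s2=0` quotient programme's feasible set), then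
`c ≤ E₀(Ĥ; 2n, S = 0)` — the bound is read at the RDM pair of the `θ`-eigen singlet ground state of §3
(`C`-feasible by necessity, `θ`-symmetric by `oneRDM_spinSwap_of_eigen` / `twoRDM_spinSwap_of_eigen`).
FORMAT-qcl1 §8c VALIDITY, singlet class. -/
theorem le_minEnergyOn_singlet_of_forall_necessary_flip {h : Λ → Λ → ℂ} {g : Λ → Λ → Λ → Λ → ℂ}
    {hnuc : ℂ} (hH : (molecularHamiltonian h g hnuc).IsHermitian) {n : ℕ} (hn : n ≤ Fintype.card Λ)
    {C : Matrix (Orb Λ) (Orb Λ) ℂ → Matrix (Orb Λ × Orb Λ) (Orb Λ × Orb Λ) ℂ → Prop}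
    (hC : IsNecessaryInSpinClass n n C) {c : ℝ}
    (hc : ∀ γ Γ, C γ Γ →
      (∀ i k', γ (Orb.spinSwap i) (Orb.spinSwap k') = γ i k') →
      (∀ i j k' l,
        Γ (Orb.spinSwap i, Orb.spinSwap j) (Orb.spinSwap k', Orb.spinSwap l) = Γ (i, j) (k', l)) →
      c ≤ (rdmEnergy h g hnuc γ Γ).re) :
    c ≤ (molecularHamiltonian h g hnuc).minEnergyOn
      (szSector (n + n) (((n : ℝ) - n) / 2) ⊓ LinearMap.ker (Matrix.toLin'
        (spinPlus : Matrix (Finset (Orb Λ)) (Finset (Orb Λ)) ℂ))) := by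
  obtain ⟨ψ, hψ, hS, hψ1, hHψ, hflip⟩ := exists_unit_eigen_singlet_spinSwap hH hn
  have hE := hc _ _ (hC ψ hψ hS hψ1) (oneRDM_spinSwap_of_eigen hflip) (twoRDM_spinSwap_of_eigen hflip)
  rwa [rdmEnergy_rdm h g hnuc hψ1, hHψ, dotProduct_smul, hψ1, smul_eq_mul, mul_one,
    Complex.ofReal_re] at hE

end Flip

/-! ### Row forms for the cell's models `F : Model k` -/

variable {k : ℕ}

/-- **SINGLET LOWER ROW FROM A FLIP-QUOTIENT CERTIFICATE, arbitrary singlet-necessary condition set.**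
Symmetric model `F`, `n ≤ k`, `C` singlet-necessary at `(n, n)`, `lo` below the energy functional of
`F`'s exact tables on the `θ`-SYMMETRIC `C`-feasible pairs ⇒ `SingletLowerRow F n lo` — what a certified
dual bound of a `qcl1f` `s2=0` instance of any rung means for the MODEL. FORMAT-qcl1 §8c + §2 [N3]. -/
theorem singletLowerRow_of_forall_necessary_flip {F : Model k} (hF : F.IsSymmetric) {n : ℕ} (hn : n ≤ k)
    {C : APosteriori.PairCondition k} (hC : IsNecessaryInSpinClass n n C) {lo : ℚ}
    (hlo : ∀ γ Γ, C γ Γ →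
      (∀ i k', γ (Orb.spinSwap i) (Orb.spinSwap k') = γ i k') →
      (∀ i j k' l,
        Γ (Orb.spinSwap i, Orb.spinSwap j) (Orb.spinSwap k', Orb.spinSwap l) = Γ (i, j) (k', l)) →
      ((lo : ℚ) : ℝ) ≤ (rdmEnergy (fun p q => (F.h p q : ℂ)) (fun p q r s => (F.eri p q r s : ℂ))
        (F.ecore : ℂ) γ Γ).re) :
    SingletLowerRow F n lo :=
  ⟨hn, le_minEnergyOn_singlet_of_forall_necessary_flip (Model.hamiltonian_isHermitian hF)
    (by simpa using hn) hC hlo⟩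

/-- Instance: the singlet `DQG` rung (`IsDQGFeasibleSinglet n`), flip form. FORMAT-qcl1 §8c. -/
theorem singletLowerRow_of_forall_isDQGFeasibleSinglet_flip {F : Model k} (hF : F.IsSymmetric) {n : ℕ}
    (hn : n ≤ k) {lo : ℚ}
    (hlo : ∀ γ Γ, IsDQGFeasibleSinglet n γ Γ →
      (∀ i k', γ (Orb.spinSwap i) (Orb.spinSwap k') = γ i k') →
      (∀ i j k' l,
        Γ (Orb.spinSwap i, Orb.spinSwap j) (Orb.spinSwap k', Orb.spinSwap l) = Γ (i, j) (k', l)) →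
      ((lo : ℚ) : ℝ) ≤ (rdmEnergy (fun p q => (F.h p q : ℂ)) (fun p q r s => (F.eri p q r s : ℂ))
        (F.ecore : ℂ) γ Γ).re) :
    SingletLowerRow F n lo :=
  singletLowerRow_of_forall_necessary_flip hF hn (isNecessaryInSpinClass_isDQGFeasibleSinglet n) hlo

/-- Instance: the singlet `DQGT1` rung — sector `DQGT1` at `(n, n)` AND the `S`-row — flip form (a
`DQGT1 --flip` instance with `s2=0`). FORMAT-qcl1 §8c. -/
theorem singletLowerRow_of_forall_isDQGT1FeasibleSector_exchangeRow_flip {F : Model k}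
    (hF : F.IsSymmetric) {n : ℕ} (hn : n ≤ k) {lo : ℚ}
    (hlo : ∀ γ Γ, IsDQGT1FeasibleSector n n γ Γ →
      ∑ x : Fin k, ∑ y : Fin k, Γ (orb x 0, orb y 1) (orb y 0, orb x 1) = (n : ℂ) →
      (∀ i k', γ (Orb.spinSwap i) (Orb.spinSwap k') = γ i k') →
      (∀ i j k' l,
        Γ (Orb.spinSwap i, Orb.spinSwap j) (Orb.spinSwap k', Orb.spinSwap l) = Γ (i, j) (k', l)) →
      ((lo : ℚ) : ℝ) ≤ (rdmEnergy (fun p q => (F.h p q : ℂ)) (fun p q r s => (F.eri p q r s : ℂ))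
        (F.ecore : ℂ) γ Γ).re) :
    SingletLowerRow F n lo :=
  singletLowerRow_of_forall_necessary_flip hF hn
    (isNecessaryInSpinClass_isDQGT1FeasibleSector_exchangeRow n n) fun γ Γ h => hlo γ Γ h.1 h.2

/-- Instance: the singlet `DQGT1T2′` rung (`IsDQGT1T2PrimeFeasibleSinglet n`), flip form. FORMAT-qcl1 §8c. -/
theorem singletLowerRow_of_forall_isDQGT1T2PrimeFeasibleSinglet_flip {F : Model k} (hF : F.IsSymmetric)
    {n : ℕ} (hn : n ≤ k) {lo : ℚ}
    (hlo : ∀ γ Γ, IsDQGT1T2PrimeFeasibleSinglet n γ Γ →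
      (∀ i k', γ (Orb.spinSwap i) (Orb.spinSwap k') = γ i k') →
      (∀ i j k' l,
        Γ (Orb.spinSwap i, Orb.spinSwap j) (Orb.spinSwap k', Orb.spinSwap l) = Γ (i, j) (k', l)) →
      ((lo : ℚ) : ℝ) ≤ (rdmEnergy (fun p q => (F.h p q : ℂ)) (fun p q r s => (F.eri p q r s : ℂ))
        (F.ecore : ℂ) γ Γ).re) :
    SingletLowerRow F n lo :=
  singletLowerRow_of_forall_necessary_flip hF hn (isNecessaryInSpinClass_isDQGT1T2PrimeFeasibleSinglet n)
    hlo

/-- **(★) FOR THE SINGLET QUANTITY FROM THE FLIP QUOTIENT**: symmetric model, `n ≤ k`, `Cnd`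
singlet-necessary, `P` any condition set implied by "`Cnd` and `θ`-symmetric" (the feasible set of a
`qcl1f` `s2=0` generator) ⇒ a `P`-feasible pair with `Re E_F ≤ Model.singletEnergy F n` (the pair of the
`θ`-eigen singlet ground state; in fact equality). -/
theorem exists_feasible_le_singletEnergy_flip_of_necessary {F : Model k} (hF : F.IsSymmetric) {n : ℕ}
    (hn : n ≤ k) {Cnd P : APosteriori.PairCondition k} (hCnd : IsNecessaryInSpinClass n n Cnd)
    (hP : ∀ γ Γ, Cnd γ Γ →
      (∀ i k', γ (Orb.spinSwap i) (Orb.spinSwap k') = γ i k') →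
      (∀ i j k' l,
        Γ (Orb.spinSwap i, Orb.spinSwap j) (Orb.spinSwap k', Orb.spinSwap l) = Γ (i, j) (k', l)) →
      P γ Γ) :
    ∃ γ Γ, P γ Γ ∧
      (rdmEnergy (fun p q => (F.h p q : ℂ)) (fun p q r s => (F.eri p q r s : ℂ)) (F.ecore : ℂ)
        γ Γ).re ≤ F.singletEnergy n := by
  obtain ⟨ψ, hψ, hS, hψ1, hHψ, hflip⟩ := exists_unit_eigen_singlet_spinSwap
    (Model.hamiltonian_isHermitian hF) (n := n) (by simpa using hn)
  refine ⟨_, _, hP _ _ (hCnd ψ hψ hS hψ1) (oneRDM_spinSwap_of_eigen hflip)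
    (twoRDM_spinSwap_of_eigen hflip), le_of_eq ?_⟩
  rw [rdmEnergy_rdm _ _ _ hψ1, hHψ, dotProduct_smul, hψ1, smul_eq_mul, mul_one, Complex.ofReal_re]
  rfl

namespace APosteriori

section EqualityForm

variable {ι : Type*} [Fintype ι] {σ : ι → Type*} [∀ j, Fintype (σ j)] [∀ j, DecidableEq (σ j)]
  {μ : Type*} [Fintype μ]

/-- **THE JANSSON BRIDGE FOR A `qcl1f` `s2=0` ENCODING (equality form)**: symmetric model, `n ≤ k`,
`Cnd` singlet-necessary, `P` implied by "`Cnd` and `θ`-symmetric", a block programme encoding `P`, any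
approximate dual `ỹ` with certified shifts `d_j` ⇒ `SingletLowerRow F n lo` for every rational
`lo ≤ c₀ + Σ_i rhs_i ỹ_i + Σ_j min(d_j, 0) τ_j`. [cite: Jansson2007, §7 Cor. 7.1 (a), p.14] -/
theorem singletLowerRow_of_isEncodingOf_flip {F : Model k} (hF : F.IsSymmetric) {n : ℕ} (hn : n ≤ k)
    {Cnd P : PairCondition k} (hCnd : IsNecessaryInSpinClass n n Cnd)
    (hP : ∀ γ Γ, Cnd γ Γ →
      (∀ i k', γ (Orb.spinSwap i) (Orb.spinSwap k') = γ i k') →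
      (∀ i j k' l,
        Γ (Orb.spinSwap i, Orb.spinSwap j) (Orb.spinSwap k', Orb.spinSwap l) = Γ (i, j) (k', l)) →
      P γ Γ)
    {C : ∀ j, Matrix (σ j) (σ j) ℝ} {A : μ → ∀ j, Matrix (σ j) (σ j) ℝ} {rhs : μ → ℝ} {τ : ι → ℝ}
    {c₀ : ℝ} (henc : IsEncodingOf F P C A rhs τ c₀) (y : μ → ℝ) (d : ι → ℝ)
    (hD : ∀ j, (C j - ∑ i, y i • A i j - d j • (1 : Matrix (σ j) (σ j) ℝ)).PosSemidef) {lo : ℚ}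
    (hlo : ((lo : ℚ) : ℝ) ≤ c₀ + ∑ i, rhs i * y i + ∑ j, min (d j) 0 * τ j) :
    SingletLowerRow F n lo :=
  singletLowerRow_of_isEncodingOf_of_exists hn henc
    (exists_feasible_le_singletEnergy_flip_of_necessary hF hn hCnd hP) y d hD hlo

end EqualityForm

section LMIForm

variable {V : Type*} [Fintype V] [DecidableEq V] {E' : Type*} [Fintype E'] {I : Type*} [Fintype I]
  {K : Type*} [Fintype K] {σ : K → Type*} [∀ q, Fintype (σ q)] [∀ q, DecidableEq (σ q)]
  {π : K → Type*} [∀ q, Fintype (π q)]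

/-- **END-TO-END FOR A FLIP-QUOTIENT SINGLET INSTANCE: a `certsdp-conic/1` `dyadic-eig` certificate on
an LMI encoding of "`Cnd` ∧ `θ`-symmetric", `Cnd` SINGLET-necessary, IS a singlet lower row.**
NOT COVERED: the float solver / float Cholesky, the reader's parsing, the per-generator encoding
property. [cite: Jansson2007, §7 Cor. 7.1 (a), p.14]
[cite: Rump1999VerifiedLargeSystems, §4 Alg. 4.1 step 7 via tree decl `DyadicCholResidualWitness.posSemidef_sub_smul_one`] -/
theorem singletLowerRow_of_dyadicEigCertificate_flip {F : Model k} (hF : F.IsSymmetric) {n : ℕ}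
    (hn : n ≤ k) {Cnd P : PairCondition k} (hCnd : IsNecessaryInSpinClass n n Cnd)
    (hP : ∀ γ Γ, Cnd γ Γ →
      (∀ i k', γ (Orb.spinSwap i) (Orb.spinSwap k') = γ i k') →
      (∀ i j k' l,
        Γ (Orb.spinSwap i, Orb.spinSwap j) (Orb.spinSwap k', Orb.spinSwap l) = Γ (i, j) (k', l)) →
      P γ Γ)
    {c : V → ℝ} {c₀ : ℝ} {u : V} {rowE : E' → V → ℝ} {rhs : E' → ℝ} {rowI : I → V → ℝ}
    {upper : I → ℝ} {Cb : ∀ q, Matrix (σ q) (σ q) ℝ} {Fm : ∀ q, V → Matrix (σ q) (σ q) ℝ}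
    {ρ : V → ℝ} {τ : K → ℝ} (henc : IsEncodingOfLMI F P c c₀ u rowE rhs rowI upper Cb Fm ρ τ)
    (lam : E' → ℝ) (κ : I → ℝ) (hκ : ∀ i, 0 ≤ κ i) (Z : ∀ q, Matrix (σ q) (σ q) ℝ)
    (hZh : ∀ q, (Z q).IsHermitian) (Rw : ∀ q, Matrix (π q) (σ q) ℝ) (dd tt sg rr : K → ℝ)
    (hdd : ∀ q, 0 < dd q) (htt : ∀ q, 0 < tt q)
    (hrow : ∀ q i,
      ∑ j, ‖DyadicCholResidualWitness.residual (Z q) (Rw q) (dd q) (tt q) (sg q) i j‖ ≤ rr q)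
    (r : V → ℝ)
    (hr : ∀ v, r v = c v - ∑ e, lam e * rowE e v + ∑ i, κ i * rowI i v - ∑ q, (Z q * Fm q v).trace)
    (β : ℝ)
    (hβ : β = c₀ + r u + ∑ e, lam e * rhs e - ∑ i, κ i * upper i - ∑ q, (Z q * Cb q).trace)
    {lo : ℚ}
    (hlo : ((lo : ℚ) : ℝ) ≤ β - ∑ v ∈ Finset.univ.erase u, |r v| * ρ v
      - ∑ q, |min 0 ((tt q * sg q - rr q) / (tt q ^ 2 * dd q))| * τ q) :
    SingletLowerRow F n lo :=
  singletLowerRow_of_dyadicEigCertificate_of_exists hn henc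
    (exists_feasible_le_singletEnergy_flip_of_necessary hF hn hCnd hP) lam κ hκ Z hZh Rw dd tt sg rr hdd
    htt hrow r hr β hβ hlo

end LMIForm

end APosteriori

end Summit.Ventures.CertifiedQuantumChemistry

end
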